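import Mathlib
import Summits.Ventures.PercRepro2.Defs
import Summits.Ventures.PercRepro2.Harris
import Summits.Ventures.PercRepro2.Graph
import Summits.Ventures.PercRepro2.Events
import Summits.Ventures.PercRepro2.PsiPinInduction
import Summits.Ventures.PercRepro2.PsiUniSure
import Summits.Ventures.PercRepro2.PsiUniExplored
import Summits.Ventures.PercRepro2.PsiTEdge
import Summits.Ventures.PercRepro2.R21PinInduction
import Summits.Ventures.PercRepro2.R21OEdgeSGraph

/-!
# The edge to `u` of the `o`-exploration satisfies (UNI-R_o) (PercRepro2, p2)

Second far-end case of the one-edge hypothesis of the frame `r21_slack_nonneg_of_uni_o`: for an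
unpinned edge `f = {x, u}` with `x` in the explored `o`-component (opening `f` merges the clusters of
`o` and `u`), the symmetric mixed term satisfies `T_f ≥ R⁰ + R¹`, hence `2·min(R⁰, R¹) ≤ T_f`.  In
the closed world (`𝟙 = {s ↮ y}`, `a = {u ∈ C_s}`, `h = {o ∈ C_s}`, `ℓ = {o ↔ y}`, `Y_u = {y ↔ u}`)
the open-world masses are `P(a ∪ h)` (three of them), `P(𝟙')` with `𝟙' = 𝟙 ∖ ((h ∩ Y_u) ∪ (a ∩ ℓ))`,
`P((a ∪ h) ∩ 𝟙')` (three of them), `P((ℓ ∪ Y_u) ∩ 𝟙')` and `0`, and the Bernstein identity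
`T_f − R⁰ − R¹ = δ(𝟙a)δ(h) + (δ(𝟙h) + δ(𝟙ℓ))δ(a) − δ(𝟙)δ(ah)` collapses to

  `T_f − R⁰ − R¹ = (A + E)·P(a ∩ hᶜ) + (F + G)·P(h ∩ aᶜ) ≥ 0`,

`A = P(𝟙 h Y_u)`, `E = P(𝟙 h aᶜ Y_uᶜ)`, `F = P(𝟙 a hᶜ ℓᶜ Y_uᶜ)`, `G = P(𝟙 Y_u hᶜ aᶜ ℓᶜ)` — four
probabilities, no BHK instance (P2-G19-YCLUSTER.md §3d′).

* `conn_update_true_s_iff_u` / `conn_update_true_y_o_iff_u` — the open world of the `u`-edge;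
* `uEdge_transfer` — the nine open-world masses as closed-world masses;
* `uEdge_masses` — the closed-world decompositions;
* `r21_uni_o_edge_u` — **the `u`-edge case of (UNI-R_o)**.
-/

namespace Summit.Ventures.PercRepro2

section UEdgeGraph

variable {V : Type*} {E : Type*} [DecidableEq E] {R : Type*} [CommRing R] [LinearOrder R]

/-- With `f = {x, u}` open and `x` in the explored `o`-component, `s ↔ v` iff `s ↔ v`, or `s ↔ o` and
`u ↔ v`, or `s ↔ u` and `o ↔ v`, in the closed world. -/
lemma conn_update_true_s_iff_u {ends : E → Sym2 V} {p : E → R} {ω : Config E} {f : E} {x s o u : V}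
    (hf : ends f = s(x, u)) (hx : Conn ends (fun e => decide (p e = 1)) o x)
    (hpf : p f ≠ 1) (h1 : ∀ e, e ≠ f → p e = 1 → ω e = true) (v : V) :
    Conn ends (Function.update ω f true) s v ↔
      Conn ends (Function.update ω f false) s v ∨
        (Conn ends (Function.update ω f false) s o ∧ Conn ends (Function.update ω f false) u v) ∨
        (Conn ends (Function.update ω f false) s u ∧ Conn ends (Function.update ω f false) o v) := by
  rw [conn_update_true_iff_or hf, conn_x_iff_o hx hpf h1]
  have hsx : Conn ends (Function.update ω f false) s x ↔ Conn ends (Function.update ω f false) s o :=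
    ⟨fun h => conn_symm ((conn_x_iff_o hx hpf h1 s).1 (conn_symm h)),
     fun h => conn_symm ((conn_x_iff_o hx hpf h1 s).2 (conn_symm h))⟩
  rw [hsx]

/-- With `f = {x, u}` open and `x` in the explored `o`-component, `y ↔ o` iff `y ↔ o` or `y ↔ u` in
the closed world. -/
lemma conn_update_true_y_o_iff_u {ends : E → Sym2 V} {p : E → R} {ω : Config E} {f : E} {x o u y : V}
    (hf : ends f = s(x, u)) (hx : Conn ends (fun e => decide (p e = 1)) o x)
    (hpf : p f ≠ 1) (h1 : ∀ e, e ≠ f → p e = 1 → ω e = true) :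
    Conn ends (Function.update ω f true) y o ↔
      Conn ends (Function.update ω f false) y o ∨ Conn ends (Function.update ω f false) y u := by
  rw [conn_update_true_iff_or hf]
  have hxo : Conn ends (Function.update ω f false) x o := (conn_x_iff_o hx hpf h1 o).2 (conn_refl _ _ _)
  constructor
  · rintro (h | ⟨hyx, _⟩ | ⟨hyu, _⟩)
    · exact Or.inl h
    · exact Or.inl (conn_trans hyx hxo)
    · exact Or.inr hyu
  · rintro (h | h)
    · exact Or.inl h
    · exact Or.inr (Or.inr ⟨h, hxo⟩)

end UEdgeGraph

section UEdgeProb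

variable {V : Type*} {E : Type*} [Fintype E] [DecidableEq E]
  {R : Type*} [CommRing R] [LinearOrder R] [IsStrictOrderedRing R]

omit [IsStrictOrderedRing R] in
/-- The nine masses of the open world `p[f↦1]` for `f = {x, u}`, `x` in the explored `o`-component,
as closed-world masses: `a` and `h` both become `a ∪ h`, `𝟙` becomes
`𝟙' = 𝟙 ∖ ((h ∩ Y_u) ∪ (a ∩ ℓ))`, `ℓ` becomes `ℓ ∪ Y_u`. -/
lemma uEdge_transfer (p : E → R) (ends : E → Sym2 V) (s y o u x : V) (f : E)
    (hf : ends f = s(x, u)) (hx : Conn ends (fun e => decide (p e = 1)) o x) (hpf : p f ≠ 1) :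
    prob (Function.update p f 1) (connEvent ends s u ∩ clusterInEvent ends s {W : Set V | o ∈ W} ∩ (connEvent ends s y)ᶜ) =
        prob (Function.update p f 0) ((connEvent ends s u ∪ connEvent ends s o) ∩
          ((connEvent ends s y)ᶜ ∩ (connEvent ends s o ∩ connEvent ends u y)ᶜ ∩ (connEvent ends s u ∩ connEvent ends o y)ᶜ)) ∧
      prob (Function.update p f 1) (connEvent ends s u ∩ connEvent ends y o ∩ (connEvent ends s y)ᶜ) =
        prob (Function.update p f 0) ((connEvent ends s u ∪ connEvent ends s o) ∩ (connEvent ends y o ∪ connEvent ends y u) ∩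
          ((connEvent ends s y)ᶜ ∩ (connEvent ends s o ∩ connEvent ends u y)ᶜ ∩ (connEvent ends s u ∩ connEvent ends o y)ᶜ)) ∧
      prob (Function.update p f 1) (connEvent ends s y)ᶜ =
        prob (Function.update p f 0) ((connEvent ends s y)ᶜ ∩ (connEvent ends s o ∩ connEvent ends u y)ᶜ ∩ (connEvent ends s u ∩ connEvent ends o y)ᶜ) ∧
      prob (Function.update p f 1) (connEvent ends s u ∩ clusterInEvent ends s {W : Set V | o ∈ W}) =
        prob (Function.update p f 0) (connEvent ends s u ∪ connEvent ends s o) ∧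
      prob (Function.update p f 1) (connEvent ends s u ∩ (connEvent ends s y)ᶜ) =
        prob (Function.update p f 0) ((connEvent ends s u ∪ connEvent ends s o) ∩
          ((connEvent ends s y)ᶜ ∩ (connEvent ends s o ∩ connEvent ends u y)ᶜ ∩ (connEvent ends s u ∩ connEvent ends o y)ᶜ)) ∧
      prob (Function.update p f 1) (clusterInEvent ends s {W : Set V | o ∈ W}) =
        prob (Function.update p f 0) (connEvent ends s u ∪ connEvent ends s o) ∧
      prob (Function.update p f 1) (clusterInEvent ends s {W : Set V | o ∈ W} ∩ (connEvent ends s y)ᶜ) =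
        prob (Function.update p f 0) ((connEvent ends s u ∪ connEvent ends s o) ∩
          ((connEvent ends s y)ᶜ ∩ (connEvent ends s o ∩ connEvent ends u y)ᶜ ∩ (connEvent ends s u ∩ connEvent ends o y)ᶜ)) ∧
      prob (Function.update p f 1) (connEvent ends s u) =
        prob (Function.update p f 0) (connEvent ends s u ∪ connEvent ends s o) ∧
      prob (Function.update p f 1) (connEvent ends y o ∩ (connEvent ends s y)ᶜ) =
        prob (Function.update p f 0) ((connEvent ends y o ∪ connEvent ends y u) ∩
          ((connEvent ends s y)ᶜ ∩ (connEvent ends s o ∩ connEvent ends u y)ᶜ ∩ (connEvent ends s u ∩ connEvent ends o y)ᶜ)) := by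
  have key : ∀ (A A' : Set (Config E)),
      (∀ ω : Config E, (∀ e, e ≠ f → p e = 1 → ω e = true) →
        (Function.update ω f true ∈ A ↔ Function.update ω f false ∈ A')) →
      prob (Function.update p f 1) A = prob (Function.update p f 0) A' :=
    fun A A' h => prob_update_one_eq_prob_update_zero_of_respects p f fun ω _ h1 => h ω h1
  have hsv : ∀ (ω : Config E), (∀ e, e ≠ f → p e = 1 → ω e = true) → ∀ v,
      Conn ends (Function.update ω f true) s v ↔
        Conn ends (Function.update ω f false) s v ∨
          (Conn ends (Function.update ω f false) s o ∧ Conn ends (Function.update ω f false) u v) ∨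
          (Conn ends (Function.update ω f false) s u ∧ Conn ends (Function.update ω f false) o v) :=
    fun ω h1 v => conn_update_true_s_iff_u hf hx hpf h1 v
  have hyo : ∀ (ω : Config E), (∀ e, e ≠ f → p e = 1 → ω e = true) →
      (Conn ends (Function.update ω f true) y o ↔
        Conn ends (Function.update ω f false) y o ∨ Conn ends (Function.update ω f false) y u) :=
    fun ω h1 => conn_update_true_y_o_iff_u hf hx hpf h1
  have hAH : ∀ (ω : Config E), (∀ e, e ≠ f → p e = 1 → ω e = true) →
      ((Conn ends (Function.update ω f true) s u ↔
        Conn ends (Function.update ω f false) s u ∨ Conn ends (Function.update ω f false) s o) ∧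
       (Conn ends (Function.update ω f true) s o ↔
        Conn ends (Function.update ω f false) s u ∨ Conn ends (Function.update ω f false) s o)) := by
    intro ω h1
    constructor
    · rw [hsv ω h1 u]
      constructor
      · rintro (h | ⟨hso, _⟩ | ⟨hsu, _⟩)
        · exact Or.inl h
        · exact Or.inr hso
        · exact Or.inl hsu
      · rintro (h | h)
        · exact Or.inl h
        · exact Or.inr (Or.inl ⟨h, conn_refl _ _ _⟩)
    · rw [hsv ω h1 o]
      constructor
      · rintro (h | ⟨hso, _⟩ | ⟨hsu, _⟩)
        · exact Or.inr h
        · exact Or.inr hso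
        · exact Or.inl hsu
      · rintro (h | h)
        · exact Or.inr (Or.inr ⟨h, conn_refl _ _ _⟩)
        · exact Or.inl h
  refine ⟨?_, ?_, ?_, ?_, ?_, ?_, ?_, ?_, ?_⟩
  · refine key _ _ fun ω h1 => ?_
    simp only [Set.mem_inter_iff, mem_connEvent, mem_clusterInEvent, Set.mem_setOf_eq, mem_cluster,
      Set.mem_compl_iff, Set.mem_union, (hAH ω h1).1, (hAH ω h1).2, hsv ω h1 y, not_or]
    tauto
  · refine key _ _ fun ω h1 => ?_
    simp only [Set.mem_inter_iff, mem_connEvent, Set.mem_compl_iff, Set.mem_union, (hAH ω h1).1,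
      hyo ω h1, hsv ω h1 y, not_or]
    tauto
  · refine key _ _ fun ω h1 => ?_
    simp only [Set.mem_inter_iff, mem_connEvent, Set.mem_compl_iff, hsv ω h1 y, not_or]
    tauto
  · refine key _ _ fun ω h1 => ?_
    simp only [Set.mem_inter_iff, mem_connEvent, mem_clusterInEvent, Set.mem_setOf_eq, mem_cluster,
      Set.mem_union, (hAH ω h1).1, (hAH ω h1).2]
    tauto
  · refine key _ _ fun ω h1 => ?_
    simp only [Set.mem_inter_iff, mem_connEvent, Set.mem_compl_iff, Set.mem_union, (hAH ω h1).1,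
      hsv ω h1 y, not_or]
    tauto
  · refine key _ _ fun ω h1 => ?_
    simp only [mem_clusterInEvent, Set.mem_setOf_eq, mem_cluster, Set.mem_union, mem_connEvent,
      (hAH ω h1).2]
  · refine key _ _ fun ω h1 => ?_
    simp only [Set.mem_inter_iff, mem_connEvent, mem_clusterInEvent, Set.mem_setOf_eq, mem_cluster,
      Set.mem_compl_iff, Set.mem_union, (hAH ω h1).2, hsv ω h1 y, not_or]
    tauto
  · refine key _ _ fun ω h1 => ?_
    simp only [mem_connEvent, Set.mem_union, (hAH ω h1).1]
  · refine key _ _ fun ω h1 => ?_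
    simp only [Set.mem_inter_iff, mem_connEvent, Set.mem_compl_iff, Set.mem_union, hyo ω h1,
      hsv ω h1 y, not_or]
    tauto

omit [LinearOrder R] [IsStrictOrderedRing R] in
/-- The closed-world decompositions for the `u`-edge, in the atoms
`t_ah1 = P(a h 𝟙)`, `B = P(a ℓ 𝟙)`, `t_1 = P(𝟙)`, `t_ah = P(a h)`, `A = P(h 𝟙 Y_u)`,
`E = P(h 𝟙 aᶜ Y_uᶜ)`, `F = P(a 𝟙 hᶜ ℓᶜ Y_uᶜ)`, `G = P(Y_u 𝟙 ℓᶜ hᶜ)`, `P(a hᶜ)`, `P(h aᶜ)`. -/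
lemma uEdge_masses (q : E → R) (ends : E → Sym2 V) (s y o u : V) :
    prob q (connEvent ends s u ∪ connEvent ends s o) =
        prob q (connEvent ends s u) + prob q (connEvent ends s o) - prob q (connEvent ends s u ∩ connEvent ends s o) ∧
      prob q ((connEvent ends s y)ᶜ ∩ (connEvent ends s o ∩ connEvent ends u y)ᶜ ∩ (connEvent ends s u ∩ connEvent ends o y)ᶜ) =
        prob q (connEvent ends s y)ᶜ - prob q (connEvent ends s o ∩ (connEvent ends s y)ᶜ ∩ connEvent ends u y) -
          prob q (connEvent ends s u ∩ connEvent ends y o ∩ (connEvent ends s y)ᶜ) ∧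
      prob q ((connEvent ends s u ∪ connEvent ends s o) ∩
          ((connEvent ends s y)ᶜ ∩ (connEvent ends s o ∩ connEvent ends u y)ᶜ ∩ (connEvent ends s u ∩ connEvent ends o y)ᶜ)) =
        prob q (connEvent ends s u ∩ (connEvent ends s y)ᶜ) - prob q (connEvent ends s u ∩ connEvent ends y o ∩ (connEvent ends s y)ᶜ) +
          prob q (connEvent ends s o ∩ (connEvent ends s y)ᶜ ∩ (connEvent ends s u)ᶜ ∩ (connEvent ends u y)ᶜ) ∧
      prob q ((connEvent ends y o ∪ connEvent ends y u) ∩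
          ((connEvent ends s y)ᶜ ∩ (connEvent ends s o ∩ connEvent ends u y)ᶜ ∩ (connEvent ends s u ∩ connEvent ends o y)ᶜ)) =
        prob q (connEvent ends y o ∩ (connEvent ends s y)ᶜ) - prob q (connEvent ends s u ∩ connEvent ends y o ∩ (connEvent ends s y)ᶜ) +
          prob q (connEvent ends y u ∩ (connEvent ends s y)ᶜ ∩ (connEvent ends y o)ᶜ ∩ (connEvent ends s o)ᶜ) ∧
      prob q ((connEvent ends s u ∪ connEvent ends s o) ∩ (connEvent ends y o ∪ connEvent ends y u) ∩
          ((connEvent ends s y)ᶜ ∩ (connEvent ends s o ∩ connEvent ends u y)ᶜ ∩ (connEvent ends s u ∩ connEvent ends o y)ᶜ)) = 0 ∧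
      prob q (connEvent ends s u ∩ (connEvent ends s y)ᶜ) =
        prob q (connEvent ends s u ∩ connEvent ends s o ∩ (connEvent ends s y)ᶜ) +
          prob q (connEvent ends s u ∩ connEvent ends y o ∩ (connEvent ends s y)ᶜ) +
          prob q (connEvent ends s u ∩ (connEvent ends s y)ᶜ ∩ (connEvent ends s o)ᶜ ∩ (connEvent ends o y)ᶜ ∩ (connEvent ends u y)ᶜ) ∧
      prob q (connEvent ends s o ∩ (connEvent ends s y)ᶜ) =
        prob q (connEvent ends s u ∩ connEvent ends s o ∩ (connEvent ends s y)ᶜ) +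
          prob q (connEvent ends s o ∩ (connEvent ends s y)ᶜ ∩ connEvent ends u y) +
          prob q (connEvent ends s o ∩ (connEvent ends s y)ᶜ ∩ (connEvent ends s u)ᶜ ∩ (connEvent ends u y)ᶜ) ∧
      prob q (connEvent ends s u) =
        prob q (connEvent ends s u ∩ connEvent ends s o) + prob q (connEvent ends s u ∩ (connEvent ends s o)ᶜ) ∧
      prob q (connEvent ends s o) =
        prob q (connEvent ends s u ∩ connEvent ends s o) + prob q (connEvent ends s o ∩ (connEvent ends s u)ᶜ) := by
  classical
  refine ⟨?_, ?_, ?_, ?_, ?_, ?_, ?_, ?_, ?_⟩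
  · -- (i1) inclusion–exclusion
    have := prob_union_add_prob_inter q (connEvent ends s u) (connEvent ends s o)
    linear_combination this
  · -- (i2): `𝟙 = 𝟙' ⊔ (𝟙 h Y_u) ⊔ (𝟙 a ℓ)`
    have h1 := prob_inter_add_prob_inter_compl q (connEvent ends s y)ᶜ
      ((connEvent ends s o ∩ connEvent ends u y) ∪ (connEvent ends s u ∩ connEvent ends o y))
    have e1 : (connEvent ends s y)ᶜ ∩ ((connEvent ends s o ∩ connEvent ends u y) ∪ (connEvent ends s u ∩ connEvent ends o y))ᶜ =
        (connEvent ends s y)ᶜ ∩ (connEvent ends s o ∩ connEvent ends u y)ᶜ ∩ (connEvent ends s u ∩ connEvent ends o y)ᶜ := by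
      rw [Set.compl_union, Set.inter_assoc]
    have e2 : (connEvent ends s y)ᶜ ∩ ((connEvent ends s o ∩ connEvent ends u y) ∪ (connEvent ends s u ∩ connEvent ends o y)) =
        (connEvent ends s o ∩ (connEvent ends s y)ᶜ ∩ connEvent ends u y) ∪
          (connEvent ends s u ∩ connEvent ends y o ∩ (connEvent ends s y)ᶜ) := by
      ext ω
      simp only [Set.mem_inter_iff, Set.mem_union, Set.mem_compl_iff, mem_connEvent]
      constructor
      · rintro ⟨hsy, ⟨hso, huy⟩ | ⟨hsu, hoy⟩⟩
        · exact Or.inl ⟨⟨hso, hsy⟩, huy⟩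
        · exact Or.inr ⟨⟨hsu, conn_symm hoy⟩, hsy⟩
      · rintro (⟨⟨hso, hsy⟩, huy⟩ | ⟨⟨hsu, hyo⟩, hsy⟩)
        · exact ⟨hsy, Or.inl ⟨hso, huy⟩⟩
        · exact ⟨hsy, Or.inr ⟨hsu, conn_symm hyo⟩⟩
    have hd : Disjoint (connEvent ends s o ∩ (connEvent ends s y)ᶜ ∩ connEvent ends u y)
        (connEvent ends s u ∩ connEvent ends y o ∩ (connEvent ends s y)ᶜ) := by
      rw [Set.disjoint_left]
      rintro ω ⟨⟨_, hsy⟩, huy⟩ ⟨⟨hsu, _⟩, _⟩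
      exact hsy (conn_trans hsu huy)
    rw [e1, e2, prob_union_of_disjoint q hd] at h1
    linear_combination h1
  · -- (i3): `(a ∪ h) ∩ 𝟙' = (a 𝟙 ℓᶜ) ⊔ (h 𝟙 aᶜ Y_uᶜ)`
    have e1 : (connEvent ends s u ∪ connEvent ends s o) ∩
        ((connEvent ends s y)ᶜ ∩ (connEvent ends s o ∩ connEvent ends u y)ᶜ ∩ (connEvent ends s u ∩ connEvent ends o y)ᶜ) =
        (connEvent ends s u ∩ (connEvent ends s y)ᶜ ∩ (connEvent ends y o)ᶜ) ∪
          (connEvent ends s o ∩ (connEvent ends s y)ᶜ ∩ (connEvent ends s u)ᶜ ∩ (connEvent ends u y)ᶜ) := by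
      ext ω
      simp only [Set.mem_inter_iff, Set.mem_union, Set.mem_compl_iff, mem_connEvent, not_and]
      constructor
      · rintro ⟨hsu | hso, ⟨hsy, h2⟩, h3⟩
        · exact Or.inl ⟨⟨hsu, hsy⟩, fun hyo => h3 hsu (conn_symm hyo)⟩
        · by_cases hsu : Conn ends ω s u
          · exact Or.inl ⟨⟨hsu, hsy⟩, fun hyo => h3 hsu (conn_symm hyo)⟩
          · exact Or.inr ⟨⟨⟨hso, hsy⟩, hsu⟩, fun huy => h2 hso huy⟩
      · rintro (⟨⟨hsu, hsy⟩, hyo⟩ | ⟨⟨⟨hso, hsy⟩, hsu⟩, huy⟩)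
        · exact ⟨Or.inl hsu, ⟨hsy, fun _ huy => hsy (conn_trans hsu huy)⟩, fun _ hoy => hyo (conn_symm hoy)⟩
        · exact ⟨Or.inr hso, ⟨hsy, fun _ huy' => huy huy'⟩, fun hsu' _ => hsu hsu'⟩
    have hd : Disjoint (connEvent ends s u ∩ (connEvent ends s y)ᶜ ∩ (connEvent ends y o)ᶜ)
        (connEvent ends s o ∩ (connEvent ends s y)ᶜ ∩ (connEvent ends s u)ᶜ ∩ (connEvent ends u y)ᶜ) := by
      rw [Set.disjoint_left]
      rintro ω ⟨⟨hsu, _⟩, _⟩ ⟨⟨_, hsu'⟩, _⟩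
      exact hsu' hsu
    have h2 := prob_inter_add_prob_inter_compl q (connEvent ends s u ∩ (connEvent ends s y)ᶜ) (connEvent ends y o)
    have e2 : connEvent ends s u ∩ (connEvent ends s y)ᶜ ∩ connEvent ends y o =
        connEvent ends s u ∩ connEvent ends y o ∩ (connEvent ends s y)ᶜ := Set.inter_right_comm _ _ _
    rw [e1, prob_union_of_disjoint q hd]
    rw [e2] at h2
    linear_combination h2
  · -- (i4): `(ℓ ∪ Y_u) ∩ 𝟙' = (ℓ 𝟙 aᶜ) ⊔ (Y_u 𝟙 ℓᶜ hᶜ)`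
    have e1 : (connEvent ends y o ∪ connEvent ends y u) ∩
        ((connEvent ends s y)ᶜ ∩ (connEvent ends s o ∩ connEvent ends u y)ᶜ ∩ (connEvent ends s u ∩ connEvent ends o y)ᶜ) =
        (connEvent ends y o ∩ (connEvent ends s y)ᶜ ∩ (connEvent ends s u)ᶜ) ∪
          (connEvent ends y u ∩ (connEvent ends s y)ᶜ ∩ (connEvent ends y o)ᶜ ∩ (connEvent ends s o)ᶜ) := by
      ext ω
      simp only [Set.mem_inter_iff, Set.mem_union, Set.mem_compl_iff, mem_connEvent, not_and]
      constructor
      · rintro ⟨hyo | hyu, ⟨hsy, h2⟩, h3⟩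
        · exact Or.inl ⟨⟨hyo, hsy⟩, fun hsu => h3 hsu (conn_symm hyo)⟩
        · by_cases hyo : Conn ends ω y o
          · exact Or.inl ⟨⟨hyo, hsy⟩, fun hsu => h3 hsu (conn_symm hyo)⟩
          · exact Or.inr ⟨⟨⟨hyu, hsy⟩, hyo⟩, fun hso => h2 hso (conn_symm hyu)⟩
      · rintro (⟨⟨hyo, hsy⟩, hsu⟩ | ⟨⟨⟨hyu, hsy⟩, hyo⟩, hso⟩)
        · exact ⟨Or.inl hyo, ⟨hsy, fun hso _ => hsy (conn_trans hso (conn_symm hyo))⟩, fun hsu' _ => hsu hsu'⟩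
        · exact ⟨Or.inr hyu, ⟨hsy, fun hso' _ => hso hso'⟩, fun _ hoy => hyo (conn_symm hoy)⟩
    have hd : Disjoint (connEvent ends y o ∩ (connEvent ends s y)ᶜ ∩ (connEvent ends s u)ᶜ)
        (connEvent ends y u ∩ (connEvent ends s y)ᶜ ∩ (connEvent ends y o)ᶜ ∩ (connEvent ends s o)ᶜ) := by
      rw [Set.disjoint_left]
      rintro ω ⟨⟨hyo, _⟩, _⟩ ⟨⟨_, hyo'⟩, _⟩
      exact hyo' hyo
    have h2 := prob_inter_add_prob_inter_compl q (connEvent ends y o ∩ (connEvent ends s y)ᶜ) (connEvent ends s u)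
    have e2 : connEvent ends y o ∩ (connEvent ends s y)ᶜ ∩ connEvent ends s u =
        connEvent ends s u ∩ connEvent ends y o ∩ (connEvent ends s y)ᶜ := by
      ext ω; simp only [Set.mem_inter_iff]; tauto
    rw [e1, prob_union_of_disjoint q hd]
    rw [e2] at h2
    linear_combination h2
  · -- (i5): the open-world mass `𝟙 ℓ a` vanishes
    have e : (connEvent ends s u ∪ connEvent ends s o) ∩ (connEvent ends y o ∪ connEvent ends y u) ∩
        ((connEvent ends s y)ᶜ ∩ (connEvent ends s o ∩ connEvent ends u y)ᶜ ∩ (connEvent ends s u ∩ connEvent ends o y)ᶜ) = ∅ := by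
      ext ω
      simp only [Set.mem_inter_iff, Set.mem_union, Set.mem_compl_iff, mem_connEvent,
        Set.mem_empty_iff_false, iff_false]
      rintro ⟨⟨hsu | hso, hyo | hyu⟩, ⟨hsy, h2⟩, h3⟩
      · exact h3 ⟨hsu, conn_symm hyo⟩
      · exact hsy (conn_trans hsu (conn_symm hyu))
      · exact hsy (conn_trans hso (conn_symm hyo))
      · exact h2 ⟨hso, conn_symm hyu⟩
    rw [e, prob_empty]
  · -- (i6): `a 𝟙 = (a h 𝟙) ⊔ (a ℓ 𝟙) ⊔ (a 𝟙 hᶜ ℓᶜ Y_uᶜ)`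
    have h1 := prob_inter_add_prob_inter_compl q (connEvent ends s u ∩ (connEvent ends s y)ᶜ) (connEvent ends s o)
    have h2 := prob_inter_add_prob_inter_compl q
      (connEvent ends s u ∩ (connEvent ends s y)ᶜ ∩ (connEvent ends s o)ᶜ) (connEvent ends o y)
    have h3 := prob_inter_add_prob_inter_compl q
      (connEvent ends s u ∩ (connEvent ends s y)ᶜ ∩ (connEvent ends s o)ᶜ ∩ (connEvent ends o y)ᶜ) (connEvent ends u y)
    have e1 : connEvent ends s u ∩ (connEvent ends s y)ᶜ ∩ connEvent ends s o =
        connEvent ends s u ∩ connEvent ends s o ∩ (connEvent ends s y)ᶜ := Set.inter_right_comm _ _ _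
    have e2 : connEvent ends s u ∩ (connEvent ends s y)ᶜ ∩ (connEvent ends s o)ᶜ ∩ connEvent ends o y =
        connEvent ends s u ∩ connEvent ends y o ∩ (connEvent ends s y)ᶜ := by
      ext ω
      simp only [Set.mem_inter_iff, Set.mem_compl_iff, mem_connEvent]
      constructor
      · rintro ⟨⟨⟨hsu, hsy⟩, _⟩, hoy⟩; exact ⟨⟨hsu, conn_symm hoy⟩, hsy⟩
      · rintro ⟨⟨hsu, hyo⟩, hsy⟩
        exact ⟨⟨⟨hsu, hsy⟩, fun hso => hsy (conn_trans hso (conn_symm hyo))⟩, conn_symm hyo⟩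
    have e3 : connEvent ends s u ∩ (connEvent ends s y)ᶜ ∩ (connEvent ends s o)ᶜ ∩ (connEvent ends o y)ᶜ ∩
        connEvent ends u y = ∅ := by
      ext ω
      simp only [Set.mem_inter_iff, Set.mem_compl_iff, mem_connEvent, Set.mem_empty_iff_false, iff_false]
      rintro ⟨⟨⟨⟨hsu, hsy⟩, _⟩, _⟩, huy⟩
      exact hsy (conn_trans hsu huy)
    rw [e1] at h1; rw [e2] at h2; rw [e3, prob_empty] at h3
    linear_combination -h1 - h2 - h3
  · -- (i7): `h 𝟙 = (a h 𝟙) ⊔ (h 𝟙 Y_u) ⊔ (h 𝟙 aᶜ Y_uᶜ)`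
    have h1 := prob_inter_add_prob_inter_compl q (connEvent ends s o ∩ (connEvent ends s y)ᶜ) (connEvent ends s u)
    have h2 := prob_inter_add_prob_inter_compl q
      (connEvent ends s o ∩ (connEvent ends s y)ᶜ ∩ (connEvent ends s u)ᶜ) (connEvent ends u y)
    have e1 : connEvent ends s o ∩ (connEvent ends s y)ᶜ ∩ connEvent ends s u =
        connEvent ends s u ∩ connEvent ends s o ∩ (connEvent ends s y)ᶜ := by
      ext ω; simp only [Set.mem_inter_iff]; tauto
    have e2 : connEvent ends s o ∩ (connEvent ends s y)ᶜ ∩ (connEvent ends s u)ᶜ ∩ connEvent ends u y =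
        connEvent ends s o ∩ (connEvent ends s y)ᶜ ∩ connEvent ends u y := by
      ext ω
      simp only [Set.mem_inter_iff, Set.mem_compl_iff, mem_connEvent]
      constructor
      · rintro ⟨⟨⟨hso, hsy⟩, _⟩, huy⟩; exact ⟨⟨hso, hsy⟩, huy⟩
      · rintro ⟨⟨hso, hsy⟩, huy⟩
        exact ⟨⟨⟨hso, hsy⟩, fun hsu => hsy (conn_trans hsu huy)⟩, huy⟩
    rw [e1] at h1; rw [e2] at h2
    linear_combination -h1 - h2
  · -- (i8)
    exact (prob_inter_add_prob_inter_compl q (connEvent ends s u) (connEvent ends s o)).symm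
  · -- (i9)
    have h := prob_inter_add_prob_inter_compl q (connEvent ends s o) (connEvent ends s u)
    rw [Set.inter_comm (connEvent ends s o) (connEvent ends s u)] at h
    linear_combination -h

/-- **The edge to `u` of the `o`-exploration satisfies (UNI-R_o).** For an unpinned edge `f = {x, u}`
with `x` in the explored `o`-component, `T_f ≥ R(p[f↦0]) + R(p[f↦1])`, hence
`2·min(R(p[f↦0]), R(p[f↦1])) ≤ T_f(p)` — the hypothesis of the frame `r21_slack_nonneg_of_uni_o` at
this edge: `T_f − R⁰ − R¹ = (A + E)·P(a hᶜ) + (F + G)·P(h aᶜ)`, four probabilities. -/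
theorem r21_uni_o_edge_u (p : E → R) (hp : IsProbVec p) (ends : E → Sym2 V) (s y o u x : V) (f : E)
    (hf : ends f = s(x, u)) (hx : Conn ends (fun e => decide (p e = 1)) o x) (hpf : p f ≠ 1) :
    2 * min (prob (Function.update p f 0) (connEvent ends s u ∩ clusterInEvent ends s {W : Set V | o ∈ W} ∩ (connEvent ends s y)ᶜ) + prob (Function.update p f 0) (connEvent ends s u ∩ connEvent ends y o ∩ (connEvent ends s y)ᶜ) + prob (Function.update p f 0) ((connEvent ends s y)ᶜ) * prob (Function.update p f 0) (connEvent ends s u ∩ clusterInEvent ends s {W : Set V | o ∈ W}) - (prob (Function.update p f 0) (connEvent ends s u ∩ (connEvent ends s y)ᶜ) * prob (Function.update p f 0) (clusterInEvent ends s {W : Set V | o ∈ W}) + prob (Function.update p f 0) (clusterInEvent ends s {W : Set V | o ∈ W} ∩ (connEvent ends s y)ᶜ) * prob (Function.update p f 0) (connEvent ends s u) + prob (Function.update p f 0) (connEvent ends y o ∩ (connEvent ends s y)ᶜ) * prob (Function.update p f 0) (connEvent ends s u))) (prob (Function.update p f 1) (connEvent ends s u ∩ clusterInEvent ends s {W :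 Set V | o ∈ W} ∩ (connEvent ends s y)ᶜ) + prob (Function.update p f 1) (connEvent ends s u ∩ connEvent ends y o ∩ (connEvent ends s y)ᶜ) + prob (Function.update p f 1) ((connEvent ends s y)ᶜ) * prob (Function.update p f 1) (connEvent ends s u ∩ clusterInEvent ends s {W : Set V | o ∈ W}) - (prob (Function.update p f 1) (connEvent ends s u ∩ (connEvent ends s y)ᶜ) * prob (Function.update p f 1) (clusterInEvent ends s {W : Set V | o ∈ W}) + prob (Function.update p f 1) (clusterInEvent ends s {W : Set V | o ∈ W} ∩ (connEvent ends s y)ᶜ) * prob (Function.update p f 1) (connEvent ends s u) + prob (Function.update p f 1) (connEvent ends y o ∩ (connEvent ends s y)ᶜ) * prob (Function.update p f 1) (connEvent ends s u))) ≤ (prob (Function.update p f 0) (connEvent ends s u ∩ clusterInEvent ends s {W : Set V | o ∈ W} ∩ (connEvent ends s y)ᶜ) + prob (Function.update p f 1) (connEvent ends s u ∩ clusterInEvent ends s {W : Set V | o ∈ W} ∩ (connEvent ends s y)ᶜ) + prob (Function.update p f 0) (connEvent ends s u ∩ connEvent ends y o ∩ (connEvent ends s y)ᶜ) + prob (Function.update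 p f 1) (connEvent ends s u ∩ connEvent ends y o ∩ (connEvent ends s y)ᶜ) + prob (Function.update p f 0) ((connEvent ends s y)ᶜ) * prob (Function.update p f 1) (connEvent ends s u ∩ clusterInEvent ends s {W : Set V | o ∈ W}) + prob (Function.update p f 1) ((connEvent ends s y)ᶜ) * prob (Function.update p f 0) (connEvent ends s u ∩ clusterInEvent ends s {W : Set V | o ∈ W}) - (prob (Function.update p f 0) (connEvent ends s u ∩ (connEvent ends s y)ᶜ) * prob (Function.update p f 1) (clusterInEvent ends s {W : Set V | o ∈ W}) + prob (Function.update p f 1) (connEvent ends s u ∩ (connEvent ends s y)ᶜ) * prob (Function.update p f 0) (clusterInEvent ends s {W : Set V | o ∈ W}) + prob (Function.update p f 0) (clusterInEvent ends s {W : Set V | o ∈ W} ∩ (connEvent ends s y)ᶜ) * prob (Function.update p f 1) (connEvent ends s u) + prob (Function.update p f 1) (clusterInEvent ends s {W : Set V | o ∈ W} ∩ (connEvent ends s y)ᶜ) * prob (Function.update p f 0) (connEvent ends s u) + prob (Function.update p f 0) (connEvent ends y o ∩ (connEvent ends s y)ᶜ) * prob (Function.update p f 1) (connEvent ends s u) +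 prob (Function.update p f 1) (connEvent ends y o ∩ (connEvent ends s y)ᶜ) * prob (Function.update p f 0) (connEvent ends s u))) := by
  classical
  have hq : IsProbVec (Function.update p f 0) := hp.update f le_rfl zero_le_one
  obtain ⟨t1, t2, t3, t4, t5, t6, t7, t8, t9⟩ := uEdge_transfer p ends s y o u x f hf hx hpf
  obtain ⟨i1, i2, i3, i4, i5, i6, i7, i8, i9⟩ := uEdge_masses (Function.update p f 0) ends s y o u
  have hh : clusterInEvent ends s {W : Set V | o ∈ W} = connEvent ends s o :=
    clusterInEvent_mem_eq_connEvent_ycl ends s o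
  rw [t1, t2, t3, t4, t5, t6, t7, t8, t9, hh, i1, i2, i3, i4, i5, i6, i7, i8, i9]
  have hA := prob_nonneg hq (connEvent ends s o ∩ (connEvent ends s y)ᶜ ∩ connEvent ends u y)
  have hE := prob_nonneg hq (connEvent ends s o ∩ (connEvent ends s y)ᶜ ∩ (connEvent ends s u)ᶜ ∩ (connEvent ends u y)ᶜ)
  have hF := prob_nonneg hq (connEvent ends s u ∩ (connEvent ends s y)ᶜ ∩ (connEvent ends s o)ᶜ ∩ (connEvent ends o y)ᶜ ∩ (connEvent ends u y)ᶜ)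
  have hG := prob_nonneg hq (connEvent ends y u ∩ (connEvent ends s y)ᶜ ∩ (connEvent ends y o)ᶜ ∩ (connEvent ends s o)ᶜ)
  have hanh := prob_nonneg hq (connEvent ends s u ∩ (connEvent ends s o)ᶜ)
  have hhna := prob_nonneg hq (connEvent ends s o ∩ (connEvent ends s u)ᶜ)
  have hmin1 := min_le_left (prob (Function.update p f 0) (connEvent ends s u ∩ connEvent ends s o ∩ (connEvent ends s y)ᶜ) + prob (Function.update p f 0) (connEvent ends s u ∩ connEvent ends y o ∩ (connEvent ends s y)ᶜ) + prob (Function.update p f 0) ((connEvent ends s y)ᶜ) * prob (Function.update p f 0) (connEvent ends s u ∩ connEvent ends s o) - ((prob (Function.update p f 0) (connEvent ends s u ∩ connEvent ends s o ∩ (connEvent ends s y)ᶜ) + prob (Function.update p f 0) (connEvent ends s u ∩ connEvent ends y o ∩ (connEvent ends s y)ᶜ) + prob (Function.update p f 0) (connEvent ends s u ∩ (connEvent ends s y)ᶜ ∩ (connEvent ends s o)ᶜ ∩ (connEvent ends o y)ᶜ ∩ (connEvent ends u y)ᶜ)) * (prob (Function.update p f 0) (connEvent ends s u ∩ connEvent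 ends s o) + prob (Function.update p f 0) (connEvent ends s o ∩ (connEvent ends s u)ᶜ)) + (prob (Function.update p f 0) (connEvent ends s u ∩ connEvent ends s o ∩ (connEvent ends s y)ᶜ) + prob (Function.update p f 0) (connEvent ends s o ∩ (connEvent ends s y)ᶜ ∩ connEvent ends u y) + prob (Function.update p f 0) (connEvent ends s o ∩ (connEvent ends s y)ᶜ ∩ (connEvent ends s u)ᶜ ∩ (connEvent ends u y)ᶜ)) * (prob (Function.update p f 0) (connEvent ends s u ∩ connEvent ends s o) + prob (Function.update p f 0) (connEvent ends s u ∩ (connEvent ends s o)ᶜ)) + prob (Function.update p f 0) (connEvent ends y o ∩ (connEvent ends s y)ᶜ) * (prob (Function.update p f 0) (connEvent ends s u ∩ connEvent ends s o) + prob (Function.update p f 0) (connEvent ends s u ∩ (connEvent ends s o)ᶜ)))) (((prob (Function.update p f 0) (connEvent ends s u ∩ connEvent ends s o ∩ (connEvent ends s y)ᶜ) + prob (Function.update p f 0) (connEvent ends s u ∩ connEvent ends y o ∩ (connEvent ends s y)ᶜ) + prob (Function.update p f 0) (connEvent ends s u ∩ (connEvent ends s y)ᶜ ∩ (connEvent ends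 s o)ᶜ ∩ (connEvent ends o y)ᶜ ∩ (connEvent ends u y)ᶜ)) - prob (Function.update p f 0) (connEvent ends s u ∩ connEvent ends y o ∩ (connEvent ends s y)ᶜ) + prob (Function.update p f 0) (connEvent ends s o ∩ (connEvent ends s y)ᶜ ∩ (connEvent ends s u)ᶜ ∩ (connEvent ends u y)ᶜ)) + 0 + (prob (Function.update p f 0) ((connEvent ends s y)ᶜ) - prob (Function.update p f 0) (connEvent ends s o ∩ (connEvent ends s y)ᶜ ∩ connEvent ends u y) - prob (Function.update p f 0) (connEvent ends s u ∩ connEvent ends y o ∩ (connEvent ends s y)ᶜ)) * (prob (Function.update p f 0) (connEvent ends s u ∩ connEvent ends s o) + prob (Function.update p f 0) (connEvent ends s u ∩ (connEvent ends s o)ᶜ) + (prob (Function.update p f 0) (connEvent ends s u ∩ connEvent ends s o) + prob (Function.update p f 0) (connEvent ends s o ∩ (connEvent ends s u)ᶜ)) - prob (Function.update p f 0) (connEvent ends s u ∩ connEvent ends s o)) - (((prob (Function.update p f 0) (connEvent ends s u ∩ connEvent ends s o ∩ (connEvent ends s y)ᶜ) + prob (Function.update p f 0) (connEvent ends s u ∩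 connEvent ends y o ∩ (connEvent ends s y)ᶜ) + prob (Function.update p f 0) (connEvent ends s u ∩ (connEvent ends s y)ᶜ ∩ (connEvent ends s o)ᶜ ∩ (connEvent ends o y)ᶜ ∩ (connEvent ends u y)ᶜ)) - prob (Function.update p f 0) (connEvent ends s u ∩ connEvent ends y o ∩ (connEvent ends s y)ᶜ) + prob (Function.update p f 0) (connEvent ends s o ∩ (connEvent ends s y)ᶜ ∩ (connEvent ends s u)ᶜ ∩ (connEvent ends u y)ᶜ)) * (prob (Function.update p f 0) (connEvent ends s u ∩ connEvent ends s o) + prob (Function.update p f 0) (connEvent ends s u ∩ (connEvent ends s o)ᶜ) + (prob (Function.update p f 0) (connEvent ends s u ∩ connEvent ends s o) + prob (Function.update p f 0) (connEvent ends s o ∩ (connEvent ends s u)ᶜ)) - prob (Function.update p f 0) (connEvent ends s u ∩ connEvent ends s o)) + ((prob (Function.update p f 0) (connEvent ends s u ∩ connEvent ends s o ∩ (connEvent ends s y)ᶜ) + prob (Function.update p f 0) (connEvent ends s u ∩ connEvent ends y o ∩ (connEvent ends s y)ᶜ) + prob (Function.update p f 0) (connEvent ends s u ∩ (connEvent ends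 s y)ᶜ ∩ (connEvent ends s o)ᶜ ∩ (connEvent ends o y)ᶜ ∩ (connEvent ends u y)ᶜ)) - prob (Function.update p f 0) (connEvent ends s u ∩ connEvent ends y o ∩ (connEvent ends s y)ᶜ) + prob (Function.update p f 0) (connEvent ends s o ∩ (connEvent ends s y)ᶜ ∩ (connEvent ends s u)ᶜ ∩ (connEvent ends u y)ᶜ)) * (prob (Function.update p f 0) (connEvent ends s u ∩ connEvent ends s o) + prob (Function.update p f 0) (connEvent ends s u ∩ (connEvent ends s o)ᶜ) + (prob (Function.update p f 0) (connEvent ends s u ∩ connEvent ends s o) + prob (Function.update p f 0) (connEvent ends s o ∩ (connEvent ends s u)ᶜ)) - prob (Function.update p f 0) (connEvent ends s u ∩ connEvent ends s o)) + (prob (Function.update p f 0) (connEvent ends y o ∩ (connEvent ends s y)ᶜ) - prob (Function.update p f 0) (connEvent ends s u ∩ connEvent ends y o ∩ (connEvent ends s y)ᶜ) + prob (Function.update p f 0) (connEvent ends y u ∩ (connEvent ends s y)ᶜ ∩ (connEvent ends y o)ᶜ ∩ (connEvent ends s o)ᶜ)) * (prob (Function.update p f 0) (connEvent ends s u ∩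 connEvent ends s o) + prob (Function.update p f 0) (connEvent ends s u ∩ (connEvent ends s o)ᶜ) + (prob (Function.update p f 0) (connEvent ends s u ∩ connEvent ends s o) + prob (Function.update p f 0) (connEvent ends s o ∩ (connEvent ends s u)ᶜ)) - prob (Function.update p f 0) (connEvent ends s u ∩ connEvent ends s o))))
  have hmin2 := min_le_right (prob (Function.update p f 0) (connEvent ends s u ∩ connEvent ends s o ∩ (connEvent ends s y)ᶜ) + prob (Function.update p f 0) (connEvent ends s u ∩ connEvent ends y o ∩ (connEvent ends s y)ᶜ) + prob (Function.update p f 0) ((connEvent ends s y)ᶜ) * prob (Function.update p f 0) (connEvent ends s u ∩ connEvent ends s o) - ((prob (Function.update p f 0) (connEvent ends s u ∩ connEvent ends s o ∩ (connEvent ends s y)ᶜ) + prob (Function.update p f 0) (connEvent ends s u ∩ connEvent ends y o ∩ (connEvent ends s y)ᶜ) + prob (Function.update p f 0) (connEvent ends s u ∩ (connEvent ends s y)ᶜ ∩ (connEvent ends s o)ᶜ ∩ (connEvent ends o y)ᶜ ∩ (connEvent ends u y)ᶜ)) * (prob (Function.update p f 0) (connEvent ends s u ∩ connEvent ends s o)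 + prob (Function.update p f 0) (connEvent ends s o ∩ (connEvent ends s u)ᶜ)) + (prob (Function.update p f 0) (connEvent ends s u ∩ connEvent ends s o ∩ (connEvent ends s y)ᶜ) + prob (Function.update p f 0) (connEvent ends s o ∩ (connEvent ends s y)ᶜ ∩ connEvent ends u y) + prob (Function.update p f 0) (connEvent ends s o ∩ (connEvent ends s y)ᶜ ∩ (connEvent ends s u)ᶜ ∩ (connEvent ends u y)ᶜ)) * (prob (Function.update p f 0) (connEvent ends s u ∩ connEvent ends s o) + prob (Function.update p f 0) (connEvent ends s u ∩ (connEvent ends s o)ᶜ)) + prob (Function.update p f 0) (connEvent ends y o ∩ (connEvent ends s y)ᶜ) * (prob (Function.update p f 0) (connEvent ends s u ∩ connEvent ends s o) + prob (Function.update p f 0) (connEvent ends s u ∩ (connEvent ends s o)ᶜ)))) (((prob (Function.update p f 0) (connEvent ends s u ∩ connEvent ends s o ∩ (connEvent ends s y)ᶜ) + prob (Function.update p f 0) (connEvent ends s u ∩ connEvent ends y o ∩ (connEvent ends s y)ᶜ) + prob (Function.update p f 0) (connEvent ends s u ∩ (connEvent ends s y)ᶜ ∩ (connEvent ends s o)ᶜ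 ∩ (connEvent ends o y)ᶜ ∩ (connEvent ends u y)ᶜ)) - prob (Function.update p f 0) (connEvent ends s u ∩ connEvent ends y o ∩ (connEvent ends s y)ᶜ) + prob (Function.update p f 0) (connEvent ends s o ∩ (connEvent ends s y)ᶜ ∩ (connEvent ends s u)ᶜ ∩ (connEvent ends u y)ᶜ)) + 0 + (prob (Function.update p f 0) ((connEvent ends s y)ᶜ) - prob (Function.update p f 0) (connEvent ends s o ∩ (connEvent ends s y)ᶜ ∩ connEvent ends u y) - prob (Function.update p f 0) (connEvent ends s u ∩ connEvent ends y o ∩ (connEvent ends s y)ᶜ)) * (prob (Function.update p f 0) (connEvent ends s u ∩ connEvent ends s o) + prob (Function.update p f 0) (connEvent ends s u ∩ (connEvent ends s o)ᶜ) + (prob (Function.update p f 0) (connEvent ends s u ∩ connEvent ends s o) + prob (Function.update p f 0) (connEvent ends s o ∩ (connEvent ends s u)ᶜ)) - prob (Function.update p f 0) (connEvent ends s u ∩ connEvent ends s o)) - (((prob (Function.update p f 0) (connEvent ends s u ∩ connEvent ends s o ∩ (connEvent ends s y)ᶜ) + prob (Function.update p f 0) (connEvent ends s u ∩ connEvent ends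 y o ∩ (connEvent ends s y)ᶜ) + prob (Function.update p f 0) (connEvent ends s u ∩ (connEvent ends s y)ᶜ ∩ (connEvent ends s o)ᶜ ∩ (connEvent ends o y)ᶜ ∩ (connEvent ends u y)ᶜ)) - prob (Function.update p f 0) (connEvent ends s u ∩ connEvent ends y o ∩ (connEvent ends s y)ᶜ) + prob (Function.update p f 0) (connEvent ends s o ∩ (connEvent ends s y)ᶜ ∩ (connEvent ends s u)ᶜ ∩ (connEvent ends u y)ᶜ)) * (prob (Function.update p f 0) (connEvent ends s u ∩ connEvent ends s o) + prob (Function.update p f 0) (connEvent ends s u ∩ (connEvent ends s o)ᶜ) + (prob (Function.update p f 0) (connEvent ends s u ∩ connEvent ends s o) + prob (Function.update p f 0) (connEvent ends s o ∩ (connEvent ends s u)ᶜ)) - prob (Function.update p f 0) (connEvent ends s u ∩ connEvent ends s o)) + ((prob (Function.update p f 0) (connEvent ends s u ∩ connEvent ends s o ∩ (connEvent ends s y)ᶜ) + prob (Function.update p f 0) (connEvent ends s u ∩ connEvent ends y o ∩ (connEvent ends s y)ᶜ) + prob (Function.update p f 0) (connEvent ends s u ∩ (connEvent ends s y)ᶜ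 ∩ (connEvent ends s o)ᶜ ∩ (connEvent ends o y)ᶜ ∩ (connEvent ends u y)ᶜ)) - prob (Function.update p f 0) (connEvent ends s u ∩ connEvent ends y o ∩ (connEvent ends s y)ᶜ) + prob (Function.update p f 0) (connEvent ends s o ∩ (connEvent ends s y)ᶜ ∩ (connEvent ends s u)ᶜ ∩ (connEvent ends u y)ᶜ)) * (prob (Function.update p f 0) (connEvent ends s u ∩ connEvent ends s o) + prob (Function.update p f 0) (connEvent ends s u ∩ (connEvent ends s o)ᶜ) + (prob (Function.update p f 0) (connEvent ends s u ∩ connEvent ends s o) + prob (Function.update p f 0) (connEvent ends s o ∩ (connEvent ends s u)ᶜ)) - prob (Function.update p f 0) (connEvent ends s u ∩ connEvent ends s o)) + (prob (Function.update p f 0) (connEvent ends y o ∩ (connEvent ends s y)ᶜ) - prob (Function.update p f 0) (connEvent ends s u ∩ connEvent ends y o ∩ (connEvent ends s y)ᶜ) + prob (Function.update p f 0) (connEvent ends y u ∩ (connEvent ends s y)ᶜ ∩ (connEvent ends y o)ᶜ ∩ (connEvent ends s o)ᶜ)) * (prob (Function.update p f 0) (connEvent ends s u ∩ connEvent ends s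 o) + prob (Function.update p f 0) (connEvent ends s u ∩ (connEvent ends s o)ᶜ) + (prob (Function.update p f 0) (connEvent ends s u ∩ connEvent ends s o) + prob (Function.update p f 0) (connEvent ends s o ∩ (connEvent ends s u)ᶜ)) - prob (Function.update p f 0) (connEvent ends s u ∩ connEvent ends s o))))
  nlinarith [mul_nonneg (add_nonneg hA hE) hanh, mul_nonneg (add_nonneg hF hG) hhna, hmin1, hmin2]

end UEdgeProb

end Summit.Ventures.PercRepro2
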